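import Literature.AlgebraicGeometry.Motives.DualNumberPoints
import Literature.AlgebraicGeometry.Motives.AbelianVarietyTranslation
import Literature.AlgebraicGeometry.Motives.AlgPointsProofs
import Literature.AlgebraicGeometry.Deformation.TrivialDeformationIdealSheaf
import HarnessLib

/-!
# Reading sections of `𝒪_{X × Spec ℂ[ε]}` at the slice points `(P, ε)`

Layer `Literature/AlgebraicGeometry/Motives`, namespace `Literature.AlgebraicGeometry.Motives.AbelianVariety`.
THEOREMS ONLY (no definition, no named fact, no instance).  For a `ℂ`-scheme `X` and a `ℂ`-point `P`, ★
`Motives/DualNumberPoints` defines the `ℂ[ε]`-point `slicePt X P = (P, ε) : Spec ℂ[ε] → X × Spec ℂ[ε]` and the local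
homomorphism `dualNumberStalkHom w : 𝒪_{Y,w(pt)} → ℂ[ε]` of a `ℂ[ε]`-point `w`.  This file reads sections of the
trivial first-order deformation `X' = X × Spec ℂ[ε]` ([Hartshorne2010] §2: `0 → 𝒪_X →ᵗ 𝒪_{X'} → 𝒪_X → 0`, split by
the projection) at these points:

* §1 (abelian varieties, [MumfordAV1970] §4 and §13 pp. 125–130): for a `ℂ[ε]`-point `w` of `A` the GROUP IDENTITY
  `slicePt A.X P ≫ (A.X ◁ w) ≫ m = w ≫ t_P` (`slicePt_comp_whiskerLeft_comp_mul` — the infinitesimal translation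
  `T_w = m ∘ (1 × w)` restricted to the slice over `P` is the translated `ℂ[ε]`-point `t_P ∘ w`) and the READ-OUT
  `dualNumberStalkHom (slicePt A.X P) (germ (T_w^♯ g)) = dualNumberStalkHom (w ≫ t_P) (germ g)`
  (`dualNumberStalkHom_slicePt_translationFamily`, `snd_…`);
* §2 values at the slice point of functions pulled back from the two factors: `dualNumberStalkHom_toSpecOver_comp`
  (a constant `ℂ[ε]`-point evaluates `c` to `c(P)`), `dualNumberStalkHom_slicePt_fst_app` (`fst♯ c ↦ c(P)`),
  `dualNumberStalkHom_slicePt_snd_appTop` (`snd♯ r ↦ r`), `dualNumberStalkHom_slicePt_flatModel` / `snd_…`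
  (`Σₖ fst♯(cₖ)·snd♯(rₖ) ↦ Σₖ cₖ(P)·rₖ`), `dualNumberStalkHom_slicePt_deformationParam` (`t ↦ ε`);
* §3 **`exists_slicePt_readout`** — EVERY section `s ∈ Γ(U, 𝒪_{X'})` reads at the slice points of the `ℂ`-points
  `P ∈ U` as `c₀(P) + ε·c₁(P)` for two sections `c₀, c₁ ∈ Γ(i⁻¹U, 𝒪_X)` independent of `P` ([Hartshorne2010] §2,
  proof of Prop. 2.6, pp. 13–14: `c₀ = i♯ s`, `c₁ = ` the preimage of `s − π♯c₀ ∈ 𝓘(U)` under ★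
  `trivialDeformationIdealIso : 𝓘 ≅ 𝒪_X`; the section-level splitting as such is ★
  `Deformation/DualNumberSectionsSplitting`).

## References

* R. Hartshorne, *Deformation Theory*, GTM 257 (2010): §2, proof of Prop. 2.6, pp. 13–14. [Hartshorne2010]
* D. Mumford, *Abelian Varieties* (1970): §4 (translations); §13, proof of the Theorem pp. 125–130. [MumfordAV1970]
* U. Görtz, T. Wedhorn, *Algebraic Geometry I* (2nd ed. 2020): (6.3)–(6.4) (tangent vectors as `k[ε]`-points),
  Prop. 3.8. [GortzWedhorn2020]
-/

set_option autoImplicit false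

noncomputable section

universe u

open CategoryTheory CategoryTheory.Limits AlgebraicGeometry Topology TopologicalSpace MonoidalCategory
open CartesianMonoidalCategory
open scoped DualNumber MonObj
open Literature.AlgebraicGeometry.Motives (AlgPoints ComplexPoints SchemeOver AbelianVariety)
open Literature.AlgebraicGeometry.Motives.AlgPoints

namespace Literature.AlgebraicGeometry.Motives.AbelianVariety

/-- The structure morphism to `specOver ℂ ℂ` is natural: `f ≫ toSpecOver Y = toSpecOver X`. [folklore] -/
private theorem comp_toSpecOver'' {X Y : SchemeOver ℂ} (f : X ⟶ Y) : f ≫ toSpecOver Y = toSpecOver X := by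
  apply Over.OverMorphism.ext
  change f.left ≫ Y.hom = X.hom
  exact Over.w f

/-! ## §1 The infinitesimal translation family read at the slice points -/

section Translation

variable (A : AbelianVariety ℂ)

/-- **`(P, ε) ≫ (1 × w) ≫ m = t_P ∘ w`**: the infinitesimal translation `T_w = m ∘ (1_A × w) : A × Spec ℂ[ε] → A`
restricted to the slice over the `ℂ`-point `P` is the `ℂ[ε]`-point `w` translated by `P` (in the group
`Hom(Spec ℂ[ε], A)`: `(const P) · w`). [cite: MumfordAV1970, §4 (translations) and §13 (proof of the Thm. pp. 125–130)] -/
theorem slicePt_comp_whiskerLeft_comp_mul (P : A.Points ℂ) (w : dualNumberOver ⟶ A.X) :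
    slicePt A.X P ≫ (A.X ◁ w) ≫ μ[A.X] = w ≫ A.translation P := by
  rw [← Category.assoc, slicePt, lift_whiskerLeft, Category.id_comp, ← Hom.mul_def,
    translation, MonObj.comp_mul, Category.comp_id, ← Category.assoc, comp_toSpecOver'']

/-- The base point of the slice point read through `T_w`: it is the base point of `w ≫ t_P`.
[cite: MumfordAV1970, §13 (proof of the Thm. pp. 125–130)] -/
theorem dualNumberBasePt_slicePt_comp (P : A.Points ℂ) (w : dualNumberOver ⟶ A.X) :
    dualNumberBasePt (slicePt A.X P ≫ (A.X ◁ w) ≫ μ[A.X]) = dualNumberBasePt (w ≫ A.translation P) := by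
  rw [slicePt_comp_whiskerLeft_comp_mul]

/-- **POINT READ-OUT (L4b).**  For a section `g` of `𝒪_A` over `U` and the infinitesimal translation
`T_w = m ∘ (1 × w) : A × Spec ℂ[ε] → A`: the value at the slice point `(P, ε)` of the pulled-back section
`T_w^♯ g` (a section of `𝒪_{A[ε]}` over `T_w⁻¹U`) is the value of `g` at the `ℂ[ε]`-point `w ≫ t_P`; in
particular their `ε`-parts agree — the left side is what a flat-model/cocycle computation on `A[ε]` produces,
the right side is what b3 identifies with `∂_v (g ∘ φ ∘ π)`. [cite: MumfordAV1970, §13 (proof of the Thm. pp. 125–130)] -/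
theorem dualNumberStalkHom_slicePt_translationFamily (P : A.Points ℂ) (w : dualNumberOver ⟶ A.X)
    (U : A.X.left.Opens) (hU : dualNumberBasePt (w ≫ A.translation P) ∈ U) (g : Γ(A.X.left, U)) :
    dualNumberStalkHom (slicePt A.X P)
        ((A.X ⊗ dualNumberOver).left.presheaf.germ (((A.X ◁ w) ≫ μ[A.X]).left ⁻¹ᵁ U)
          (dualNumberBasePt (slicePt A.X P))
          ((dualNumberBasePt_slicePt_comp A P w).symm ▸ hU :
            dualNumberBasePt (slicePt A.X P ≫ (A.X ◁ w) ≫ μ[A.X]) ∈ U)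
          (((A.X ◁ w) ≫ μ[A.X]).left.app U g)) =
      dualNumberStalkHom (w ≫ A.translation P) (A.X.left.presheaf.germ U _ hU g) := by
  rw [← dualNumberStalkHom_comp_germ]
  exact dualNumberStalkHom_congr (slicePt_comp_whiskerLeft_comp_mul A P w) U _ hU g

/-- The `ε`-parts in the read-out agree (the form consumed by the cocycle side). [cite: MumfordAV1970, §13 (proof of the Thm. pp. 125–130)] -/
theorem snd_dualNumberStalkHom_slicePt_translationFamily (P : A.Points ℂ) (w : dualNumberOver ⟶ A.X)
    (U : A.X.left.Opens) (hU : dualNumberBasePt (w ≫ A.translation P) ∈ U) (g : Γ(A.X.left, U)) :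
    (dualNumberStalkHom (slicePt A.X P)
        ((A.X ⊗ dualNumberOver).left.presheaf.germ (((A.X ◁ w) ≫ μ[A.X]).left ⁻¹ᵁ U)
          (dualNumberBasePt (slicePt A.X P))
          ((dualNumberBasePt_slicePt_comp A P w).symm ▸ hU :
            dualNumberBasePt (slicePt A.X P ≫ (A.X ◁ w) ≫ μ[A.X]) ∈ U)
          (((A.X ◁ w) ≫ μ[A.X]).left.app U g))).snd =
      (dualNumberStalkHom (w ≫ A.translation P) (A.X.left.presheaf.germ U _ hU g)).snd := by
  rw [dualNumberStalkHom_slicePt_translationFamily]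

end Translation

/-! ## §2 Values at the slice point of functions pulled back from the two factors -/

section Factors

variable {X : SchemeOver ℂ}

/-- The base point of a CONSTANT `ℂ[ε]`-point `Spec ℂ[ε] → Spec ℂ → X` is the point of `P`.
[cite: GortzWedhorn2020, (6.3)–(6.4)] -/
theorem dualNumberBasePt_toSpecOver_comp (P : AlgPoints X ℂ) :
    dualNumberBasePt (toSpecOver dualNumberOver ≫ P) = P.pt := by
  change P.left.base ((toSpecOver dualNumberOver).left.base _) = P.left.base _
  congr 1
  exact Subsingleton.elim (α := PrimeSpectrum ℂ) _ _

/-- **Value of a function at a CONSTANT `ℂ[ε]`-point**: the `ℂ[ε]`-point `Spec ℂ[ε] → Spec ℂ -P→ X` sends the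
germ of `c` to the constant `c(P) = c(P) + 0·ε` (Mathlib `Scheme.germ_stalkClosedPointTo_Spec` + ★
`AlgPoints.eval_eq_appLE`). [cite: GortzWedhorn2020, (6.3)–(6.4)] -/
theorem dualNumberStalkHom_toSpecOver_comp (P : AlgPoints X ℂ) (V : X.left.Opens) (hP : P.pt ∈ V)
    (h : dualNumberBasePt (toSpecOver dualNumberOver ≫ P) ∈ V) (c : Γ(X.left, V)) :
    dualNumberStalkHom (toSpecOver dualNumberOver ≫ P) (X.left.presheaf.germ V _ h c) =
      algebraMap ℂ ℂ[ε] (P.eval V hP c) := by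
  haveI : IsLocalRing (CommRingCat.of ℂ[ε]) := isLocalRing_of_dualNumber
  rw [dualNumberStalkHom_comp_germ]
  -- move the section of `Spec ℂ` over `P⁻¹V` to `⊤`
  have hle : (⊤ : (Spec (.of ℂ)).Opens) ≤ P.left ⁻¹ᵁ V := (AlgPoints.preimage_eq_top P hP).ge
  have hg : (specOver ℂ ℂ).left.presheaf.germ (P.left ⁻¹ᵁ V) (dualNumberBasePt (toSpecOver dualNumberOver)) h
      (P.left.app V c) =
      (Spec (.of ℂ)).presheaf.germ ⊤ (dualNumberBasePt (toSpecOver dualNumberOver)) trivial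
        ((Spec (.of ℂ)).presheaf.map (homOfLE hle).op (P.left.app V c)) := by
    rw [TopCat.Presheaf.germ_res_apply]
    rfl
  rw [hg]
  change ((Spec (.of ℂ)).presheaf.germ ⊤ _ trivial ≫
    Scheme.stalkClosedPointTo (Spec.map (CommRingCat.ofHom (algebraMap ℂ ℂ[ε])))) _ = _
  rw [Scheme.germ_stalkClosedPointTo_Spec, AlgPoints.eval_eq_appLE P V hP c]
  rfl

/-- **Value at the slice point `(P, ε)` of a function pulled back from `X`**: it is the constant `c(P)`.
[cite: GortzWedhorn2020, (6.3)–(6.4)] -/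
theorem dualNumberStalkHom_slicePt_fst_app (P : AlgPoints X ℂ) (V : X.left.Opens) (hP : P.pt ∈ V)
    (h : dualNumberBasePt (slicePt X P ≫ fst _ _) ∈ V) (c : Γ(X.left, V)) :
    dualNumberStalkHom (slicePt X P)
        ((X ⊗ dualNumberOver).left.presheaf.germ ((fst X dualNumberOver).left ⁻¹ᵁ V)
          (dualNumberBasePt (slicePt X P)) h ((fst X dualNumberOver).left.app V c)) =
      algebraMap ℂ ℂ[ε] (P.eval V hP c) := by
  rw [← dualNumberStalkHom_comp_germ,
    dualNumberStalkHom_congr (slicePt_fst X P) V h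
      (by rw [dualNumberBasePt_toSpecOver_comp]; exact hP) c]
  exact dualNumberStalkHom_toSpecOver_comp P V hP _ c

/-- The identity of `Spec ℂ[ε]` written as `Over.homMk (Spec.map 𝟙)` (plumbing for Mathlib's
`germ_stalkClosedPointTo_Spec`). [folklore] -/
private theorem id_dualNumberOver_eq :
    𝟙 dualNumberOver = Over.homMk (Spec.map (𝟙 (CommRingCat.of ℂ[ε]))) (by rw [Spec.map_id]; rfl) := by
  ext : 1
  change 𝟙 _ = Spec.map (𝟙 _)
  rw [Spec.map_id]

/-- **Value at the slice point `(P, ε)` of a function pulled back from `Spec ℂ[ε]`**: it is that element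
of `ℂ[ε]` (`ε ↦ ε`). [cite: GortzWedhorn2020, (6.3)–(6.4)] -/
theorem dualNumberStalkHom_slicePt_snd_appTop (P : AlgPoints X ℂ) (t : Γ(Spec (.of ℂ[ε]), ⊤)) :
    dualNumberStalkHom (slicePt X P)
        ((X ⊗ dualNumberOver).left.presheaf.germ ⊤ (dualNumberBasePt (slicePt X P)) trivial
          ((snd X dualNumberOver).left.appTop t)) =
      (Scheme.ΓSpecIso (.of ℂ[ε])).hom t := by
  haveI : IsLocalRing (CommRingCat.of ℂ[ε]) := isLocalRing_of_dualNumber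
  have h1 : dualNumberStalkHom (slicePt X P)
      ((X ⊗ dualNumberOver).left.presheaf.germ ⊤ (dualNumberBasePt (slicePt X P)) trivial
        ((snd X dualNumberOver).left.appTop t)) =
      dualNumberStalkHom (slicePt X P ≫ snd X dualNumberOver)
        (dualNumberOver.left.presheaf.germ ⊤ (dualNumberBasePt (slicePt X P ≫ snd X dualNumberOver)) trivial t) :=
    (dualNumberStalkHom_comp_germ (slicePt X P) (snd X dualNumberOver) ⊤ trivial t).symm
  rw [h1, dualNumberStalkHom_congr ((slicePt_snd X P).trans id_dualNumberOver_eq) ⊤ trivial trivial t]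
  change ((Spec (.of ℂ[ε])).presheaf.germ ⊤ _ trivial ≫
    Scheme.stalkClosedPointTo (Spec.map (𝟙 (CommRingCat.of ℂ[ε])))) t = _
  rw [Scheme.germ_stalkClosedPointTo_Spec]
  rfl

/-- **(L4a-core) Value at the slice point of a FLAT-MODEL section** `Σₖ fst^♯(cₖ) · snd^♯(rₖ)` over
`fst⁻¹V`: it is `Σₖ cₖ(P) · rₖ ∈ ℂ[ε]`.  (With the affine base change `Γ(fst⁻¹V) = Γ(V) ⊗_ℂ ℂ[ε]` — the
(L1) leaf — every section over an affine `V` is of this form.) [cite: GortzWedhorn2020, (6.3)–(6.4)]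
[cite: MumfordAV1970, §13 (proof of the Thm. pp. 125–130)] -/
theorem dualNumberStalkHom_slicePt_flatModel (P : AlgPoints X ℂ) (V : X.left.Opens) (hP : P.pt ∈ V)
    (h : dualNumberBasePt (slicePt X P) ∈ (fst X dualNumberOver).left ⁻¹ᵁ V)
    {m : ℕ} (c : Fin m → Γ(X.left, V)) (r : Fin m → ℂ[ε]) :
    dualNumberStalkHom (slicePt X P)
        ((X ⊗ dualNumberOver).left.presheaf.germ ((fst X dualNumberOver).left ⁻¹ᵁ V)
          (dualNumberBasePt (slicePt X P)) h
          (∑ k, (fst X dualNumberOver).left.app V (c k) *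
            (X ⊗ dualNumberOver).left.presheaf.map (homOfLE le_top).op
              ((snd X dualNumberOver).left.appTop ((Scheme.ΓSpecIso (.of ℂ[ε])).inv (r k))))) =
      ∑ k, algebraMap ℂ ℂ[ε] (P.eval V hP (c k)) * r k := by
  rw [map_sum, map_sum]
  refine Finset.sum_congr rfl fun k _ => ?_
  rw [map_mul, map_mul, dualNumberStalkHom_slicePt_fst_app P V hP h (c k), TopCat.Presheaf.germ_res_apply,
    dualNumberStalkHom_slicePt_snd_appTop, ← CommRingCat.comp_apply, Iso.inv_hom_id]
  rfl

/-- The `ε`-part of the flat-model value: `Σₖ cₖ(P) · (rₖ).snd`. [cite: GortzWedhorn2020, (6.3)–(6.4)] -/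
theorem snd_dualNumberStalkHom_slicePt_flatModel (P : AlgPoints X ℂ) (V : X.left.Opens) (hP : P.pt ∈ V)
    (h : dualNumberBasePt (slicePt X P) ∈ (fst X dualNumberOver).left ⁻¹ᵁ V)
    {m : ℕ} (c : Fin m → Γ(X.left, V)) (r : Fin m → ℂ[ε]) :
    (dualNumberStalkHom (slicePt X P)
        ((X ⊗ dualNumberOver).left.presheaf.germ ((fst X dualNumberOver).left ⁻¹ᵁ V)
          (dualNumberBasePt (slicePt X P)) h
          (∑ k, (fst X dualNumberOver).left.app V (c k) *
            (X ⊗ dualNumberOver).left.presheaf.map (homOfLE le_top).op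
              ((snd X dualNumberOver).left.appTop ((Scheme.ΓSpecIso (.of ℂ[ε])).inv (r k)))))).snd =
      ∑ k, P.eval V hP (c k) * (r k).snd := by
  rw [dualNumberStalkHom_slicePt_flatModel P V hP h c r, TrivSqZeroExt.snd_sum]
  refine Finset.sum_congr rfl fun k _ => ?_
  rw [TrivSqZeroExt.algebraMap_eq_inl, DualNumber.snd_mul, TrivSqZeroExt.fst_inl, TrivSqZeroExt.snd_inl,
    zero_mul, add_zero]

end Factors

/-! ## §3 Every section of `𝒪_{X[ε]}` reads at the slice points as `(c₀(P), c₁(P))` -/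

section Combined

open Literature.AlgebraicGeometry.Deformation

variable (X : SchemeOver ℂ)

/-- The value of the deformation parameter `t` (★ `deformationParam X`, the pull-back of `ε`) at a slice point is `ε`.
[cite: Hartshorne2010, §2 proof of Prop. 2.6, p. 13] -/
theorem dualNumberStalkHom_slicePt_deformationParam (P : AlgPoints X ℂ) :
    dualNumberStalkHom (slicePt X P)
        ((X ⊗ dualNumberOver).left.presheaf.germ ⊤ (dualNumberBasePt (slicePt X P)) trivial (deformationParam X)) =
      (ε : ℂ[ε]) := by
  have h := dualNumberStalkHom_slicePt_snd_appTop (X := X) P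
    ((Scheme.ΓSpecIso (.of ℂ[ε])).inv (ε : ℂ[ε]))
  rw [Iso.inv_hom_id_apply] at h
  exact h

/-- **(L1 + L4) EVERY section `s` of `𝒪_{X × Spec ℂ[ε]}` over an open `U` reads, at the slice point `(P, ε)` of
every `ℂ`-point `P` of the closed fibre in `U`, as `c₀(P) + ε·c₁(P)`** for two sections `c₀, c₁ ∈ Γ(X, i⁻¹U)` of `𝒪_X`
INDEPENDENT of `P` — `c₀ = i♯ s` and `c₁` the preimage of `s − π♯c₀ ∈ 𝓘(U)` under ★ `𝓘 = t·𝒪_{X'} ≅ 𝒪_X`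
(`trivialDeformationIdealIso`, [Hartshorne2010] Prop. 2.6: `0 → 𝒪_X →ᵗ 𝒪_{X'} → 𝒪_X → 0` split by `π = fst`; the
section-level splitting as such is ★ `Deformation/DualNumberSectionsSplitting`).
[cite: Hartshorne2010, §2 proof of Prop. 2.6, pp. 13–14] [cite: GortzWedhorn2020, (6.3)–(6.4)] -/
theorem exists_slicePt_readout (U : (X ⊗ dualNumberOver).left.Opens) (s : Γ((X ⊗ dualNumberOver).left, U)) :
    ∃ c₀ c₁ : Γ(X.left, (closedFibreι X (ArtAlg.sqZeroExt (k := ℂ) ℂ)) ⁻¹ᵁ U),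
      ∀ (P : AlgPoints X ℂ) (hP : P.pt ∈ (closedFibreι X (ArtAlg.sqZeroExt (k := ℂ) ℂ)) ⁻¹ᵁ U)
        (h : dualNumberBasePt (slicePt X P) ∈ U),
        (dualNumberStalkHom (slicePt X P) ((X ⊗ dualNumberOver).left.presheaf.germ U _ h s)).fst =
            P.eval _ hP c₀ ∧
          (dualNumberStalkHom (slicePt X P) ((X ⊗ dualNumberOver).left.presheaf.germ U _ h s)).snd =
            P.eval _ hP c₁ := by
  haveI : IsLocalRing (CommRingCat.of ℂ[ε]) := isLocalRing_of_dualNumber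
  -- the split first-order thickening `i : X ↪ X' = X × Spec ℂ[ε]`, `π = fst`, parameter `t`
  let D := ArtAlg.sqZeroExt (k := ℂ) ℂ
  let i : X.left ⟶ (X ⊗ dualNumberOver).left := closedFibreι X D
  let r : (X ⊗ dualNumberOver).left ⟶ X.left := pullback.fst X.hom D.specOver.hom
  have hr : i ≫ r = 𝟙 _ := closedFibreι_fst X D
  haveI : IsFirstOrderThickening i := isFirstOrderThickening_closedFibreι_dualNumber X
  let t : Γ((X ⊗ dualNumberOver).left, ⊤) := deformationParam X
  have ht : i.appTop t = 0 := closedFibreι_appTop_deformationParam X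
  -- `μ = i♯ s`, and `s - π♯ μ ∈ 𝓘(U) = t · π♯ Γ(X, i⁻¹U)`
  let c₀ : Γ(X.left, i ⁻¹ᵁ U) := i.app U s
  have ha : i.app U (s - retractionApp i r hr U c₀) = 0 := by
    rw [map_sub, app_retractionApp, sub_self]
  let e := trivialDeformationIdealIso X
  let c₁ : Γ(X.left, i ⁻¹ᵁ U) := (e.hom.hom.app (Opposite.op U)).hom (idealLift i U _ ha)
  have hη : paramMulApp i r hr t ht U c₁ = idealLift i U _ ha := by
    have h1 : ((e.hom ≫ e.inv).hom.app (Opposite.op U)).hom (idealLift i U _ ha) = idealLift i U _ ha := by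
      rw [e.hom_inv_id]; rfl
    rw [← paramMul_app_apply i r hr t ht U c₁]
    exact h1
  have hs : s = retractionApp i r hr U c₀ + sectionOn t U * retractionApp i r hr U c₁ := by
    have h2 := congrArg (idealVal i U) hη
    rw [idealVal_paramMulApp, idealVal_idealLift] at h2
    rw [h2, add_sub_cancel]
  refine ⟨c₀, c₁, fun P hP h => ?_⟩
  -- values at the slice point: `π♯ y ↦ y(P)`, `t ↦ ε`
  have hval : ∀ y : Γ(X.left, i ⁻¹ᵁ U),
      dualNumberStalkHom (slicePt X P) ((X ⊗ dualNumberOver).left.presheaf.germ U _ h (retractionApp i r hr U y)) =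
        algebraMap ℂ ℂ[ε] (P.eval _ hP y) := by
    intro y
    rw [retractionApp_def, Scheme.Hom.appLE, CommRingCat.comp_apply, TopCat.Presheaf.germ_res_apply]
    exact dualNumberStalkHom_slicePt_fst_app P (i ⁻¹ᵁ U) hP _ y
  have htval : dualNumberStalkHom (slicePt X P) ((X ⊗ dualNumberOver).left.presheaf.germ U _ h (sectionOn t U)) =
      (ε : ℂ[ε]) := by
    rw [sectionOn_def, TopCat.Presheaf.germ_res_apply]
    exact dualNumberStalkHom_slicePt_deformationParam X P
  have e1 : dualNumberStalkHom (slicePt X P) ((X ⊗ dualNumberOver).left.presheaf.germ U _ h s) =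
      algebraMap ℂ ℂ[ε] (P.eval _ hP c₀) + (ε : ℂ[ε]) * algebraMap ℂ ℂ[ε] (P.eval _ hP c₁) := by
    rw [hs, map_add, map_add, map_mul, map_mul, hval, hval, htval]
  rw [e1, TrivSqZeroExt.algebraMap_eq_inl]
  refine ⟨?_, ?_⟩
  · rw [TrivSqZeroExt.fst_add, TrivSqZeroExt.fst_inl, TrivSqZeroExt.fst_mul, DualNumber.fst_eps, zero_mul,
      add_zero]
  · rw [TrivSqZeroExt.snd_add, TrivSqZeroExt.snd_inl, DualNumber.snd_mul, DualNumber.fst_eps, DualNumber.snd_eps,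
      TrivSqZeroExt.fst_inl, TrivSqZeroExt.snd_inl, zero_mul, one_mul, zero_add, zero_add]

end Combined

end Literature.AlgebraicGeometry.Motives.AbelianVariety

end
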